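import Summits.QuantumFields.BalabanUV.Beta.GAN24.StaircasePairing

/-!
# `BalabanUV.Beta.GAN24.ContactRefinePWeights` — binder row G-an2-4 / (CONV-C), the row owner's CONTACT-TERM ROUTE, CT-4c SHAPE P (road-P2 chair):
# THE OWNER's PAIRING WEIGHTS FOR «GEOMETRIC + ONE FINEST SPIKE» LETTERS — the rows the differenced staircases of CT-4b produce
# (`aΔ s = α₀·[s = 0] + θ^k·α·Lc^s`): the spike ROW `s₁ = 0` costs `(K+1)·2e^{2κ₀}τα₀β` and the spike COLUMN `s₂ = 0` costs `2e^{5κ₀}αβ₀((K+1)τ + 2Φ₀Lc^K)`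
# — the design's (δ) count «`(k+2)·Lc^{−(k+1)}` relative, the only log» — and `(K+1)·(Lc^K)⁻¹ ≤ 2·(3∕(2Lc))^K` absorbs the log into a rate `< 1` for `Lc ≥ 2`.

NOT IN PRINT; OUR BOOKKEEPING (road-P2 chair `b2b-balaban-gan24-p2`, gen 34; «MINE (CT-4c-P)»; pure real algebra over the owner gan24-p1-g18's
`StaircasePairing.sum_weights_le_of_geometric` ∕ `sum_pow_le` BY NAME).  HONEST FRAMING (cell contract, verbatim): «discharging `BetaPertH` makes Bałaban's UV
stability UNCONDITIONAL — a real constructive-QFT result; it is NOT the continuum limit and NOT the Clay problem.»  HONEST DEPENDENCY (verbatim): «continuum YM on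
T⁴ ⇐ BetaPertH ∧ nine spine estimates (0/9 proved); BetaPertH ⇐ (D1) ∧ (D4) ∧ CAP+tail; G-an2-4 gates asym, D1 and NE2/3/4.»  0 `def`, 0 cited facts, 0 `def … : Prop`,
0 sorry; NO estimate of Bałaban's; discharges NOTHING of hSdev; NEVER «G-an2-4 closed»; NOT (CONV-C) as typed, NOT D1, NOT BetaPertH, NOT continuum, NOT Clay.

## Contents (the weight `w s₁ s₂ = if s₁ ≤ s₂ then 2e^{2κ₀}·τ·a s₁·b s₂·(Lc^{s₂})⁻¹ else 2e^{5κ₀}·(Φ₀ + τ·(Lc^{s₁})⁻¹)·a s₁·b s₂`, summed over `range (K+1)²`)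
* `sum_weights_mono` (monotone in nonnegative letters), `sum_weights_add_left` ∕ `sum_weights_add_right` (additive in each letter family);
* **`sum_weights_spike_left_le`** (`a = α₀·[· = 0]`, `b s ≤ β·Lc^s`): `≤ ((K:ℝ)+1)·(2e^{2κ₀}·τ·α₀·β)`;
* **`sum_weights_spike_right_le`** (`a s ≤ α·Lc^s`, `b = β₀·[· = 0]`): `≤ 2e^{5κ₀}·α·β₀·(((K:ℝ)+1)·τ + 2·Φ₀·Lc^K)`;
* **`sum_weights_spike_geometric_left_le`** (`a s ≤ α₀·[s = 0] + α·Lc^s`, `b s ≤ β·Lc^s`): `≤ ((K:ℝ)+1)·(2e^{2κ₀}τα₀β) + 8e^{5κ₀}αβLc^K(2τ + Φ₀Lc^K)`,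
  **`sum_weights_spike_geometric_right_le`** (the mirror);
* `succ_mul_inv_pow_le` : `((K:ℝ)+1)·((Lc:ℝ)^K)⁻¹ ≤ 2·(3∕(2·Lc))^K` (Bernoulli), `three_div_two_mul_lt_one` (`2 ≤ Lc ⇒ 3∕(2Lc) < 1`).
-/

noncomputable section

open Finset
open scoped BigOperators

namespace Summit.QuantumFields.BalabanUV.Beta.GAN24.ContactRefinePWeights

open Summit.QuantumFields.BalabanUV.Beta.GAN24.StaircasePairing (sum_weights_le_of_geometric sum_pow_le)

section Weights

variable {Lc K : ℕ} {κ₀ τ Φ₀ : ℝ}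

/-- [folklore] Each weight is `(nonnegative coefficient) × (a s₁ · b s₂)`. -/
theorem weight_eq_coef_mul (a b : ℕ → ℝ) (s₁ s₂ : ℕ) :
    (if s₁ ≤ s₂ then 2 * Real.exp (2 * κ₀) * τ * a s₁ * b s₂ * (((Lc : ℝ) ^ s₂))⁻¹
      else 2 * Real.exp (5 * κ₀) * (Φ₀ + τ * (((Lc : ℝ) ^ s₁))⁻¹) * a s₁ * b s₂)
    = (if s₁ ≤ s₂ then 2 * Real.exp (2 * κ₀) * τ * (((Lc : ℝ) ^ s₂))⁻¹
        else 2 * Real.exp (5 * κ₀) * (Φ₀ + τ * (((Lc : ℝ) ^ s₁))⁻¹)) * (a s₁ * b s₂) := by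
  split_ifs <;> ring

/-- [folklore] … with a nonnegative coefficient (`τ, Φ₀ ≥ 0`). -/
theorem coef_nonneg (hτ : 0 ≤ τ) (hΦ : 0 ≤ Φ₀) (s₁ s₂ : ℕ) :
    0 ≤ (if s₁ ≤ s₂ then 2 * Real.exp (2 * κ₀) * τ * (((Lc : ℝ) ^ s₂))⁻¹
        else 2 * Real.exp (5 * κ₀) * (Φ₀ + τ * (((Lc : ℝ) ^ s₁))⁻¹)) := by
  split_ifs <;> positivity

/-- [folklore] **THE WEIGHT SUM IS MONOTONE IN NONNEGATIVE LETTERS.** -/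
theorem sum_weights_mono (hτ : 0 ≤ τ) (hΦ : 0 ≤ Φ₀) {a a' b b' : ℕ → ℝ}
    (ha : ∀ s, 0 ≤ a s) (haa : ∀ s, a s ≤ a' s) (hbb : ∀ s, b s ≤ b' s) (hb : ∀ s, 0 ≤ b s) :
    (∑ s₁ ∈ Finset.range (K + 1), ∑ s₂ ∈ Finset.range (K + 1),
        (if s₁ ≤ s₂ then 2 * Real.exp (2 * κ₀) * τ * a s₁ * b s₂ * (((Lc : ℝ) ^ s₂))⁻¹
         else 2 * Real.exp (5 * κ₀) * (Φ₀ + τ * (((Lc : ℝ) ^ s₁))⁻¹) * a s₁ * b s₂))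
    ≤ (∑ s₁ ∈ Finset.range (K + 1), ∑ s₂ ∈ Finset.range (K + 1),
        (if s₁ ≤ s₂ then 2 * Real.exp (2 * κ₀) * τ * a' s₁ * b' s₂ * (((Lc : ℝ) ^ s₂))⁻¹
         else 2 * Real.exp (5 * κ₀) * (Φ₀ + τ * (((Lc : ℝ) ^ s₁))⁻¹) * a' s₁ * b' s₂)) := by
  refine Finset.sum_le_sum fun s₁ _ => Finset.sum_le_sum fun s₂ _ => ?_
  rw [weight_eq_coef_mul a b, weight_eq_coef_mul a' b']
  exact mul_le_mul_of_nonneg_left (mul_le_mul (haa s₁) (hbb s₂) (hb s₂) ((ha s₁).trans (haa s₁))) (coef_nonneg hτ hΦ s₁ s₂)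

/-- [folklore] **THE WEIGHT SUM IS ADDITIVE IN THE FIRST LETTER FAMILY.** -/
theorem sum_weights_add_left (a₁ a₂ b : ℕ → ℝ) :
    (∑ s₁ ∈ Finset.range (K + 1), ∑ s₂ ∈ Finset.range (K + 1),
        (if s₁ ≤ s₂ then 2 * Real.exp (2 * κ₀) * τ * (a₁ s₁ + a₂ s₁) * b s₂ * (((Lc : ℝ) ^ s₂))⁻¹
         else 2 * Real.exp (5 * κ₀) * (Φ₀ + τ * (((Lc : ℝ) ^ s₁))⁻¹) * (a₁ s₁ + a₂ s₁) * b s₂))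
    = (∑ s₁ ∈ Finset.range (K + 1), ∑ s₂ ∈ Finset.range (K + 1),
        (if s₁ ≤ s₂ then 2 * Real.exp (2 * κ₀) * τ * a₁ s₁ * b s₂ * (((Lc : ℝ) ^ s₂))⁻¹
         else 2 * Real.exp (5 * κ₀) * (Φ₀ + τ * (((Lc : ℝ) ^ s₁))⁻¹) * a₁ s₁ * b s₂))
      + (∑ s₁ ∈ Finset.range (K + 1), ∑ s₂ ∈ Finset.range (K + 1),
        (if s₁ ≤ s₂ then 2 * Real.exp (2 * κ₀) * τ * a₂ s₁ * b s₂ * (((Lc : ℝ) ^ s₂))⁻¹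
         else 2 * Real.exp (5 * κ₀) * (Φ₀ + τ * (((Lc : ℝ) ^ s₁))⁻¹) * a₂ s₁ * b s₂)) := by
  rw [← Finset.sum_add_distrib]
  refine Finset.sum_congr rfl fun s₁ _ => ?_
  rw [← Finset.sum_add_distrib]
  refine Finset.sum_congr rfl fun s₂ _ => ?_
  rw [weight_eq_coef_mul (fun s => a₁ s + a₂ s) b, weight_eq_coef_mul a₁ b, weight_eq_coef_mul a₂ b]
  ring

/-- [folklore] **THE WEIGHT SUM IS ADDITIVE IN THE SECOND LETTER FAMILY.** -/
theorem sum_weights_add_right (a b₁ b₂ : ℕ → ℝ) :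
    (∑ s₁ ∈ Finset.range (K + 1), ∑ s₂ ∈ Finset.range (K + 1),
        (if s₁ ≤ s₂ then 2 * Real.exp (2 * κ₀) * τ * a s₁ * (b₁ s₂ + b₂ s₂) * (((Lc : ℝ) ^ s₂))⁻¹
         else 2 * Real.exp (5 * κ₀) * (Φ₀ + τ * (((Lc : ℝ) ^ s₁))⁻¹) * a s₁ * (b₁ s₂ + b₂ s₂)))
    = (∑ s₁ ∈ Finset.range (K + 1), ∑ s₂ ∈ Finset.range (K + 1),
        (if s₁ ≤ s₂ then 2 * Real.exp (2 * κ₀) * τ * a s₁ * b₁ s₂ * (((Lc : ℝ) ^ s₂))⁻¹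
         else 2 * Real.exp (5 * κ₀) * (Φ₀ + τ * (((Lc : ℝ) ^ s₁))⁻¹) * a s₁ * b₁ s₂))
      + (∑ s₁ ∈ Finset.range (K + 1), ∑ s₂ ∈ Finset.range (K + 1),
        (if s₁ ≤ s₂ then 2 * Real.exp (2 * κ₀) * τ * a s₁ * b₂ s₂ * (((Lc : ℝ) ^ s₂))⁻¹
         else 2 * Real.exp (5 * κ₀) * (Φ₀ + τ * (((Lc : ℝ) ^ s₁))⁻¹) * a s₁ * b₂ s₂)) := by
  rw [← Finset.sum_add_distrib]
  refine Finset.sum_congr rfl fun s₁ _ => ?_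
  rw [← Finset.sum_add_distrib]
  refine Finset.sum_congr rfl fun s₂ _ => ?_
  rw [weight_eq_coef_mul a (fun s => b₁ s + b₂ s), weight_eq_coef_mul a b₁, weight_eq_coef_mul a b₂]
  ring

/-- NOT IN PRINT; OUR BOOKKEEPING.  **THE SPIKE ROW** (`a = α₀·[· = 0]`, `b s ≤ β·Lc^s`, `1 ≤ Lc`): only `s₁ = 0 ≤ s₂` contributes, each pair at most
`2e^{2κ₀}·τ·α₀·β` (the `(Lc^{s₂})⁻¹` eats `b`'s growth) ⟹ `≤ ((K:ℝ)+1)·(2e^{2κ₀}·τ·α₀·β)` — the design's (δ) log. -/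
theorem sum_weights_spike_left_le (hτ : 0 ≤ τ) (hLc : 1 ≤ Lc) {α₀ β : ℝ} (hα₀ : 0 ≤ α₀) {b : ℕ → ℝ}
    (hb : ∀ s, 0 ≤ b s) (hbL : ∀ s, b s ≤ β * (Lc : ℝ) ^ s) :
    (∑ s₁ ∈ Finset.range (K + 1), ∑ s₂ ∈ Finset.range (K + 1),
        (if s₁ ≤ s₂ then 2 * Real.exp (2 * κ₀) * τ * (if s₁ = 0 then α₀ else 0) * b s₂ * (((Lc : ℝ) ^ s₂))⁻¹
         else 2 * Real.exp (5 * κ₀) * (Φ₀ + τ * (((Lc : ℝ) ^ s₁))⁻¹) * (if s₁ = 0 then α₀ else 0) * b s₂))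
    ≤ ((K : ℝ) + 1) * (2 * Real.exp (2 * κ₀) * τ * α₀ * β) := by
  have hL0 : (0 : ℝ) < Lc := by exact_mod_cast hLc
  have hterm : ∀ s₁ ∈ Finset.range (K + 1), ∀ s₂ ∈ Finset.range (K + 1),
      (if s₁ ≤ s₂ then 2 * Real.exp (2 * κ₀) * τ * (if s₁ = 0 then α₀ else 0) * b s₂ * (((Lc : ℝ) ^ s₂))⁻¹
         else 2 * Real.exp (5 * κ₀) * (Φ₀ + τ * (((Lc : ℝ) ^ s₁))⁻¹) * (if s₁ = 0 then α₀ else 0) * b s₂)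
        ≤ if s₁ = 0 then 2 * Real.exp (2 * κ₀) * τ * α₀ * β else 0 := by
    intro s₁ _ s₂ _
    by_cases h0 : s₁ = 0
    · subst h0
      rw [if_pos (Nat.zero_le s₂), if_pos rfl, if_pos rfl]
      have hLs : (0 : ℝ) < (Lc : ℝ) ^ s₂ := pow_pos hL0 _
      have hq : b s₂ * (((Lc : ℝ) ^ s₂))⁻¹ ≤ β := by
        rw [← div_eq_mul_inv, div_le_iff₀ hLs]; exact hbL s₂
      have hq0 : 0 ≤ b s₂ * (((Lc : ℝ) ^ s₂))⁻¹ := mul_nonneg (hb s₂) (by positivity)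
      calc 2 * Real.exp (2 * κ₀) * τ * α₀ * b s₂ * ((Lc : ℝ) ^ s₂)⁻¹ = (2 * Real.exp (2 * κ₀) * τ * α₀) * (b s₂ * ((Lc : ℝ) ^ s₂)⁻¹) := by ring
        _ ≤ (2 * Real.exp (2 * κ₀) * τ * α₀) * β := mul_le_mul_of_nonneg_left hq (by positivity)
        _ = _ := by ring
    · rw [if_neg h0, if_neg h0]
      split_ifs <;> simp
  calc _ ≤ ∑ s₁ ∈ Finset.range (K + 1), ∑ _s₂ ∈ Finset.range (K + 1), (if s₁ = 0 then 2 * Real.exp (2 * κ₀) * τ * α₀ * β else 0) :=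
        Finset.sum_le_sum fun s₁ hs₁ => Finset.sum_le_sum fun s₂ hs₂ => hterm s₁ hs₁ s₂ hs₂
    _ = ((K : ℝ) + 1) * (2 * Real.exp (2 * κ₀) * τ * α₀ * β) := by
        rw [Finset.sum_comm, Finset.sum_const, Finset.card_range, nsmul_eq_mul,
          Finset.sum_ite_eq' (Finset.range (K + 1)) 0, if_pos (Finset.mem_range.2 (Nat.succ_pos K))]
        push_cast; ring

/-- NOT IN PRINT; OUR BOOKKEEPING.  **THE SPIKE COLUMN** (`a s ≤ α·Lc^s`, `b = β₀·[· = 0]`, `2 ≤ Lc`): only `s₂ = 0` contributes; the pair `(0,0)` weighs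
`≤ 2e^{2κ₀}ταβ₀`, the pairs `s₁ ≥ 1` (derivative on the coarser `ψ`-piece) weigh `≤ 2e^{5κ₀}β₀(Φ₀αLc^{s₁} + τα)` ⟹ `≤ 2e^{5κ₀}·α·β₀·(((K:ℝ)+1)·τ + 2·Φ₀·Lc^K)`. -/
theorem sum_weights_spike_right_le (hκ : 0 ≤ κ₀) (hτ : 0 ≤ τ) (hΦ : 0 ≤ Φ₀) (hLc : 2 ≤ Lc) {α β₀ : ℝ} (hα : 0 ≤ α) (hβ₀ : 0 ≤ β₀)
    {a : ℕ → ℝ} (ha : ∀ s, 0 ≤ a s) (haL : ∀ s, a s ≤ α * (Lc : ℝ) ^ s) :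
    (∑ s₁ ∈ Finset.range (K + 1), ∑ s₂ ∈ Finset.range (K + 1),
        (if s₁ ≤ s₂ then 2 * Real.exp (2 * κ₀) * τ * a s₁ * (if s₂ = 0 then β₀ else 0) * (((Lc : ℝ) ^ s₂))⁻¹
         else 2 * Real.exp (5 * κ₀) * (Φ₀ + τ * (((Lc : ℝ) ^ s₁))⁻¹) * a s₁ * (if s₂ = 0 then β₀ else 0)))
    ≤ 2 * Real.exp (5 * κ₀) * α * β₀ * (((K : ℝ) + 1) * τ + 2 * Φ₀ * (Lc : ℝ) ^ K) := by
  have hL : (2 : ℝ) ≤ (Lc : ℝ) := by exact_mod_cast hLc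
  have hL0 : (0 : ℝ) < (Lc : ℝ) := by linarith
  have h25 : Real.exp (2 * κ₀) ≤ Real.exp (5 * κ₀) := Real.exp_le_exp.2 (by nlinarith)
  -- each `s₁`: the `s₂ = 0` term only, bounded by `2e^{5κ₀}β₀(τα + Φ₀αLc^{s₁})`
  have hrow : ∀ s₁ ∈ Finset.range (K + 1),
      (∑ s₂ ∈ Finset.range (K + 1),
        (if s₁ ≤ s₂ then 2 * Real.exp (2 * κ₀) * τ * a s₁ * (if s₂ = 0 then β₀ else 0) * (((Lc : ℝ) ^ s₂))⁻¹
         else 2 * Real.exp (5 * κ₀) * (Φ₀ + τ * (((Lc : ℝ) ^ s₁))⁻¹) * a s₁ * (if s₂ = 0 then β₀ else 0)))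
        ≤ 2 * Real.exp (5 * κ₀) * β₀ * (τ * α) + 2 * Real.exp (5 * κ₀) * β₀ * (Φ₀ * α) * (Lc : ℝ) ^ s₁ := by
    intro s₁ _
    have hterm : ∀ s₂ ∈ Finset.range (K + 1),
        (if s₁ ≤ s₂ then 2 * Real.exp (2 * κ₀) * τ * a s₁ * (if s₂ = 0 then β₀ else 0) * (((Lc : ℝ) ^ s₂))⁻¹
           else 2 * Real.exp (5 * κ₀) * (Φ₀ + τ * (((Lc : ℝ) ^ s₁))⁻¹) * a s₁ * (if s₂ = 0 then β₀ else 0))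
          ≤ if s₂ = 0 then 2 * Real.exp (5 * κ₀) * β₀ * (τ * α) + 2 * Real.exp (5 * κ₀) * β₀ * (Φ₀ * α) * (Lc : ℝ) ^ s₁ else 0 := by
      intro s₂ _
      by_cases h0 : s₂ = 0
      · subst h0
        rw [if_pos rfl, if_pos rfl]
        have hLs : (0 : ℝ) < (Lc : ℝ) ^ s₁ := pow_pos hL0 _
        have ha1 : a s₁ ≤ α * (Lc : ℝ) ^ s₁ := haL s₁
        have hq : a s₁ * (((Lc : ℝ) ^ s₁))⁻¹ ≤ α := by
          rw [← div_eq_mul_inv, div_le_iff₀ hLs]; exact ha1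
        by_cases hle : s₁ ≤ 0
        · have hs : s₁ = 0 := Nat.le_zero.1 hle
          subst hs
          rw [if_pos le_rfl]
          simp only [pow_zero, inv_one, mul_one]
          have ha0 : a 0 ≤ α := by simpa using haL 0
          have h1 : 2 * Real.exp (2 * κ₀) * τ * a 0 * β₀ ≤ 2 * Real.exp (5 * κ₀) * τ * α * β₀ := by
            have ha00 := ha 0
            gcongr
          have h2 : 0 ≤ 2 * Real.exp (5 * κ₀) * β₀ * (Φ₀ * α) := by positivity
          nlinarith [h1, h2]
        · rw [if_neg hle]
          have e : 2 * Real.exp (5 * κ₀) * (Φ₀ + τ * ((Lc : ℝ) ^ s₁)⁻¹) * a s₁ * β₀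
              = 2 * Real.exp (5 * κ₀) * β₀ * (τ * (a s₁ * ((Lc : ℝ) ^ s₁)⁻¹)) + 2 * Real.exp (5 * κ₀) * β₀ * (Φ₀ * a s₁) := by ring
          rw [e]
          have h0 : 0 ≤ 2 * Real.exp (5 * κ₀) * β₀ := by positivity
          exact add_le_add (mul_le_mul_of_nonneg_left (mul_le_mul_of_nonneg_left hq hτ) h0)
            ((mul_le_mul_of_nonneg_left (mul_le_mul_of_nonneg_left ha1 hΦ) h0).trans_eq (by ring))
      · rw [if_neg h0, if_neg h0]
        split_ifs <;> simp
    calc _ ≤ ∑ s₂ ∈ Finset.range (K + 1),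
          (if s₂ = 0 then 2 * Real.exp (5 * κ₀) * β₀ * (τ * α) + 2 * Real.exp (5 * κ₀) * β₀ * (Φ₀ * α) * (Lc : ℝ) ^ s₁ else 0) :=
          Finset.sum_le_sum hterm
      _ = _ := by rw [Finset.sum_ite_eq' (Finset.range (K + 1)) 0, if_pos (Finset.mem_range.2 (Nat.succ_pos K))]
  calc _ ≤ ∑ s₁ ∈ Finset.range (K + 1), (2 * Real.exp (5 * κ₀) * β₀ * (τ * α) + 2 * Real.exp (5 * κ₀) * β₀ * (Φ₀ * α) * (Lc : ℝ) ^ s₁) :=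
        Finset.sum_le_sum hrow
    _ = ((K : ℝ) + 1) * (2 * Real.exp (5 * κ₀) * β₀ * (τ * α))
          + 2 * Real.exp (5 * κ₀) * β₀ * (Φ₀ * α) * ∑ s₁ ∈ Finset.range (K + 1), (Lc : ℝ) ^ s₁ := by
        rw [Finset.sum_add_distrib, Finset.sum_const, Finset.card_range, nsmul_eq_mul, Finset.mul_sum]; push_cast; ring
    _ ≤ ((K : ℝ) + 1) * (2 * Real.exp (5 * κ₀) * β₀ * (τ * α)) + 2 * Real.exp (5 * κ₀) * β₀ * (Φ₀ * α) * (2 * (Lc : ℝ) ^ K) :=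
        add_le_add le_rfl (mul_le_mul_of_nonneg_left (sum_pow_le hL K) (by positivity))
    _ = 2 * Real.exp (5 * κ₀) * α * β₀ * (((K : ℝ) + 1) * τ + 2 * Φ₀ * (Lc : ℝ) ^ K) := by ring

/-- NOT IN PRINT; OUR BOOKKEEPING.  **«GEOMETRIC + FINEST SPIKE» IN THE FIRST FAMILY** (`a s ≤ α₀·[s = 0] + α·Lc^s`, `b s ≤ β·Lc^s`, `2 ≤ Lc`):
`Σ w ≤ ((K:ℝ)+1)·(2e^{2κ₀}τα₀β) + 8e^{5κ₀}·α·β·Lc^K·(2τ + Φ₀·Lc^K)` (additivity + the spike row + the owner's `sum_weights_le_of_geometric`). -/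
theorem sum_weights_spike_geometric_left_le (hκ : 0 ≤ κ₀) (hτ : 0 ≤ τ) (hΦ : 0 ≤ Φ₀) (hLc : 2 ≤ Lc) {α₀ α β : ℝ}
    (hα₀ : 0 ≤ α₀) (hα : 0 ≤ α) (hβ : 0 ≤ β) {a b : ℕ → ℝ} (ha : ∀ s, 0 ≤ a s) (hb : ∀ s, 0 ≤ b s)
    (haL : ∀ s, a s ≤ (if s = 0 then α₀ else 0) + α * (Lc : ℝ) ^ s) (hbL : ∀ s, b s ≤ β * (Lc : ℝ) ^ s) :
    (∑ s₁ ∈ Finset.range (K + 1), ∑ s₂ ∈ Finset.range (K + 1),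
        (if s₁ ≤ s₂ then 2 * Real.exp (2 * κ₀) * τ * a s₁ * b s₂ * (((Lc : ℝ) ^ s₂))⁻¹
         else 2 * Real.exp (5 * κ₀) * (Φ₀ + τ * (((Lc : ℝ) ^ s₁))⁻¹) * a s₁ * b s₂))
    ≤ ((K : ℝ) + 1) * (2 * Real.exp (2 * κ₀) * τ * α₀ * β) + 8 * Real.exp (5 * κ₀) * α * β * (Lc : ℝ) ^ K * (2 * τ + Φ₀ * (Lc : ℝ) ^ K) := by
  have hL1 : 1 ≤ Lc := le_trans (by norm_num) hLc
  have hsp : ∀ s, 0 ≤ (if s = 0 then α₀ else 0) + α * (Lc : ℝ) ^ s := fun s => by split_ifs <;> positivity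
  refine (sum_weights_mono (K := K) (κ₀ := κ₀) (Lc := Lc) hτ hΦ ha haL (fun s => le_rfl) hb).trans ?_
  rw [sum_weights_add_left]
  refine add_le_add (sum_weights_spike_left_le (Φ₀ := Φ₀) hτ hL1 hα₀ hb hbL) ?_
  exact sum_weights_le_of_geometric hLc hκ hτ hΦ hα hβ (fun s => by positivity) hb (fun s => le_rfl) hbL

/-- NOT IN PRINT; OUR BOOKKEEPING.  **«GEOMETRIC + FINEST SPIKE» IN THE SECOND FAMILY** (`a s ≤ α·Lc^s`, `b s ≤ β₀·[s = 0] + β·Lc^s`, `2 ≤ Lc`):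
`Σ w ≤ 2e^{5κ₀}·α·β₀·(((K:ℝ)+1)·τ + 2·Φ₀·Lc^K) + 8e^{5κ₀}·α·β·Lc^K·(2τ + Φ₀·Lc^K)`. -/
theorem sum_weights_spike_geometric_right_le (hκ : 0 ≤ κ₀) (hτ : 0 ≤ τ) (hΦ : 0 ≤ Φ₀) (hLc : 2 ≤ Lc) {α β₀ β : ℝ}
    (hα : 0 ≤ α) (hβ₀ : 0 ≤ β₀) (hβ : 0 ≤ β) {a b : ℕ → ℝ} (ha : ∀ s, 0 ≤ a s) (hb : ∀ s, 0 ≤ b s)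
    (haL : ∀ s, a s ≤ α * (Lc : ℝ) ^ s) (hbL : ∀ s, b s ≤ (if s = 0 then β₀ else 0) + β * (Lc : ℝ) ^ s) :
    (∑ s₁ ∈ Finset.range (K + 1), ∑ s₂ ∈ Finset.range (K + 1),
        (if s₁ ≤ s₂ then 2 * Real.exp (2 * κ₀) * τ * a s₁ * b s₂ * (((Lc : ℝ) ^ s₂))⁻¹
         else 2 * Real.exp (5 * κ₀) * (Φ₀ + τ * (((Lc : ℝ) ^ s₁))⁻¹) * a s₁ * b s₂))
    ≤ 2 * Real.exp (5 * κ₀) * α * β₀ * (((K : ℝ) + 1) * τ + 2 * Φ₀ * (Lc : ℝ) ^ K)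
      + 8 * Real.exp (5 * κ₀) * α * β * (Lc : ℝ) ^ K * (2 * τ + Φ₀ * (Lc : ℝ) ^ K) := by
  have hsp : ∀ s, 0 ≤ (if s = 0 then β₀ else 0) + β * (Lc : ℝ) ^ s := fun s => by split_ifs <;> positivity
  refine (sum_weights_mono (K := K) (κ₀ := κ₀) (Lc := Lc) hτ hΦ ha (fun s => le_rfl) hbL hb).trans ?_
  rw [sum_weights_add_right]
  refine add_le_add (sum_weights_spike_right_le hκ hτ hΦ hLc hα hβ₀ ha haL) ?_
  exact sum_weights_le_of_geometric hLc hκ hτ hΦ hα hβ ha (fun s => by positivity) haL (fun s => le_rfl)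

end Weights

/-! ## The log is absorbed: `(K+1)·Lc^{−K} ≤ 2·(3∕(2Lc))^K` -/

/-- [folklore] Bernoulli: `(K:ℝ) + 1 ≤ 2·(3∕2)^K`. -/
theorem succ_le_two_mul_pow (K : ℕ) : (K : ℝ) + 1 ≤ 2 * ((3 : ℝ) / 2) ^ K := by
  have h := one_add_mul_le_pow (show (-2 : ℝ) ≤ 1 / 2 by norm_num) K
  have e : (1 : ℝ) + 1 / 2 = 3 / 2 := by norm_num
  rw [e] at h
  linarith

/-- [folklore] **THE LOG ABSORBED**: `((K:ℝ)+1)·((Lc:ℝ)^K)⁻¹ ≤ 2·(3∕(2·Lc))^K` (`0 < Lc`). -/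
theorem succ_mul_inv_pow_le {Lc : ℕ} (hLc : 0 < Lc) (K : ℕ) :
    ((K : ℝ) + 1) * (((Lc : ℝ) ^ K))⁻¹ ≤ 2 * ((3 : ℝ) / (2 * Lc)) ^ K := by
  have hL0 : (0 : ℝ) < Lc := by exact_mod_cast hLc
  have hLK : (0 : ℝ) < (Lc : ℝ) ^ K := pow_pos hL0 _
  have e : ((3 : ℝ) / (2 * Lc)) ^ K = ((3 : ℝ) / 2) ^ K * (((Lc : ℝ) ^ K))⁻¹ := by
    rw [show (3 : ℝ) / (2 * Lc) = (3 / 2) * (Lc : ℝ)⁻¹ by field_simp, mul_pow, inv_pow]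
  rw [e, ← mul_assoc]
  exact mul_le_mul_of_nonneg_right (succ_le_two_mul_pow K) (by positivity)

/-- [folklore] `2 ≤ Lc ⇒ 0 ≤ 3∕(2Lc) < 1`. -/
theorem three_div_two_mul_lt_one {Lc : ℕ} (hLc : 2 ≤ Lc) : 0 ≤ (3 : ℝ) / (2 * Lc) ∧ (3 : ℝ) / (2 * Lc) < 1 := by
  have hL : (2 : ℝ) ≤ (Lc : ℝ) := by exact_mod_cast hLc
  refine ⟨by positivity, ?_⟩
  rw [div_lt_one (by linarith)]
  linarith

end Summit.QuantumFields.BalabanUV.Beta.GAN24.ContactRefinePWeights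

end
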